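/- LEAD seat `ym-line-cbag-p1` (prover-ym-line-cbag-p1-g23-0) leading LINE 7 `GlueballBandRecursion` (ideator ym-idea-2): the consolidated
door — ONE object, the effective one-particle Bloch symbol family (`EffectiveBlochSymbolFamily`, Theorems/GlueballBandRecursionEffectiveBlochSymbolDefs.lean),
implies all three cruxes K1 ⟨stmt-QuantumFields-27508⟩, K2 ⟨27507⟩, K3′ ⟨27554⟩ and hence, through the route's deciding theorem `closes` and the
proved glue `assembly2_proof`, the rung `ColdDoublingRecursionStrongCoupling`.  (In the theses cone by nature: it concludes route decls and the rung.) -/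
import Summits.QuantumFields.YangMills.Theorems.GlueballBandRecursionOneGlueballBandDichotomyBlochDoor
import Summits.QuantumFields.YangMills.Theorems.GlueballBandRecursionAssembly2
import Summits.QuantumFields.YangMills.Theorems.GlueballBandRecursionEffectiveBlochSymbolDefs

/-!
# Route `GlueballBandRecursion`: the rung `ColdDoublingRecursionStrongCoupling` from the effective one-particle Bloch symbol family

`EffectiveBlochSymbolFamily` (the consolidated XL target P1 of the LEAD's blueprint v4 on crux 27554; see its Defs file for the reading)
⟹ `GapStableUnderRefinement` (K1, `D = 2(D' + 3Kπ²)`) ∧ `ThermalMultiplicityUpper` (K2, `A = 2n₀ + 1`) ∧ `OneGlueballBandDichotomy` (K3′, via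
the Bloch door) ⟹ `ColdDoublingRecursionStrongCoupling` (`closes … assembly2_proof`).

* §1 `le_rate_of_eventually_mul_pow_le_traceExcess`: the twin of the thermal door's rate lemma — an eventual LOWER trace bound `c·W^{k+2} ≤ x_{k+2}`
  gives `W ≤ q_N`.
* §2 `rate_eq_and_bracket_of_blochSymbol` (per volume): from a Bloch symbol with two-sided trace control at all large times, the largest
  Bloch-block eigenvalue `W` IS the rate (`q_N = W`), `W ≤ Λ` (the attained supremum of the Rayleigh quotients), `Λ e^{−3Kπ²/N²} ≤ W` (round the
  maximiser to the nearest lattice angle — one use of the second-difference bound, no differentiability), and `Σ_p Re tr B̃(θp)^t ≤ n N³ W^t`.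
* §3 the three cruxes and the rung.

HONEST FRAMING.  Conditional on `EffectiveBlochSymbolFamily` — the finite-torus, β-uniform one-particle theorem of the strong-coupling transfer
matrix (XL; template Borgs–Imbrie CMP 145 (1992) Thm A; not in print for the periodic torus).  The rung is RECORD-type and strong-coupling only;
nothing here bears on the Yang–Mills mass gap.
-/

set_option autoImplicit false

noncomputable section

open scoped InnerProductSpace ComplexOrder
open Filter Topology MeasureTheory Finset
open Literature.MathematicalPhysics.QuantumFieldTheory
open Literature.MathematicalPhysics.QuantumFieldTheory.Balaban1983to89.Missing (strongCouplingRadius)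
open Summit.QuantumFields.YangMills.Theses.GlueballBandRecursion

namespace Summit.QuantumFields.YangMills.Theorems.GlueballBandRecursion.Band

/-! ### §1 Two more rate lemmas: the lower eventual trace bound pins the rate from below -/

/-- **The top weight sits under the rate (eventual form)**: if `c·W^{k+2} ≤ x_{k+2}(N)` for all `k ≥ k₀` (`c > 0`, `W ≥ 0`, `β ≥ 0`) then
`W ≤ q_N` (`(c W^{k+2})^{1/(k+2)} = c^{1/(k+2)} W → W` and `x_{k+2}^{1/(k+2)} → q_N`). -/
theorem le_rate_of_eventually_mul_pow_le_traceExcess {G : Type} [Group G] [TopologicalSpace G] [IsTopologicalGroup G]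
    [CompactSpace G] [MeasurableSpace G] [BorelSpace G] (r : LatticeRep G) {β : ℝ} (hβ : 0 ≤ β) (N : ℕ) [NeZero N]
    {c W : ℝ} (hc : 0 < c) (hW : 0 ≤ W) (k₀ : ℕ)
    (h : ∀ k : ℕ, k₀ ≤ k → c * W ^ (k + 2) ≤ traceExcess r.ρ β N (k + 2)) :
    W ≤ ⨅ k : ℕ, traceExcess r.ρ β N (k + 2) ^ ((1 : ℝ) / ((k : ℝ) + 2)) := by
  haveI : SecondCountableTopology G :=
    (r.continuous.isClosedEmbedding r.injective).isEmbedding.secondCountableTopology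
  have hlim := tendsto_root_traceExcess r hβ N
  have hlim' : Tendsto (fun k : ℕ => c ^ ((1 : ℝ) / ((k : ℝ) + 2)) * W) atTop (𝓝 W) := by
    have h := (tendsto_const_rpow_inv_add_two hc).mul_const W
    rwa [one_mul] at h
  refine le_of_tendsto_of_tendsto hlim' hlim ?_
  rw [Filter.EventuallyLE, Filter.eventually_atTop]
  refine ⟨k₀, fun k hk => ?_⟩
  have hexp : 0 ≤ (1 : ℝ) / ((k : ℝ) + 2) := by positivity
  have hexp' : (1 : ℝ) / ((k : ℝ) + 2) = ((k + 2 : ℕ) : ℝ)⁻¹ := by push_cast; rw [one_div]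
  have hcW : 0 ≤ c * W ^ (k + 2) := mul_nonneg hc.le (pow_nonneg hW _)
  calc c ^ ((1 : ℝ) / ((k : ℝ) + 2)) * W
      = c ^ ((1 : ℝ) / ((k : ℝ) + 2)) * (W ^ (k + 2)) ^ ((1 : ℝ) / ((k : ℝ) + 2)) := by
        rw [hexp', Real.pow_rpow_inv_natCast hW (by omega)]
    _ = (c * W ^ (k + 2)) ^ ((1 : ℝ) / ((k : ℝ) + 2)) := (Real.mul_rpow hc.le (pow_nonneg hW _)).symm
    _ ≤ traceExcess r.ρ β N (k + 2) ^ ((1 : ℝ) / ((k : ℝ) + 2)) := Real.rpow_le_rpow hcW (h k hk) hexp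

/-! ### §2 Per-volume consequences of a Bloch symbol: weights, the rate, the continuum supremum -/

section PerVolume

variable {G : Type} [Group G] [TopologicalSpace G] [IsTopologicalGroup G] [CompactSpace G]
  [MeasurableSpace G] [BorelSpace G]

/-- **The Bloch blocks identify the rate and bracket it by the continuum supremum.**  For `β ≥ 0`, `N`, a periodic Hermitian symbol `B̃`
(`n ≥ 1`) with positive log-C² (constant `K ≥ 0`) Rayleigh quotients, an attained supremum `Λ` of the Rayleigh quotients, and two-sided
trace control for all `m ≥ m₀`: with `W` the largest eigenvalue of the Bloch blocks `B̃(θp)`,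
(i) `q_N = W`, (ii) `W ≤ Λ`, (iii) `Λ·e^{−3Kπ²/N²} ≤ W` (round the maximiser to the nearest lattice angle and use the second-difference
bound once), and (iv) for every `m`: `Σ_p Re tr B̃(θp)^{m+2} ≤ n·N³·W^{m+2}`. -/
theorem rate_eq_and_bracket_of_blochSymbol (r : LatticeRep G) {β : ℝ} (hβ : 0 ≤ β) (N : ℕ) [NeZero N]
    {K : ℝ} (hK : 0 ≤ K) {n : ℕ} (hn : 0 < n) (Bt : (Fin 3 → ℝ) → Matrix (Fin n) (Fin n) ℂ)
    (hH : ∀ q, (Bt q).IsHermitian)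
    (hper : ∀ (q : Fin 3 → ℝ) (z : Fin 3 → ℤ), Bt (fun i => q i + 2 * Real.pi * z i) = Bt q)
    (hray : ∀ u : EuclideanSpace ℂ (Fin n), ‖u‖ = 1 →
      (∀ q, 0 < RCLike.re ⟪u, Matrix.toEuclideanLin (Bt q) u⟫_ℂ) ∧
      ∀ x v : Fin 3 → ℝ,
        2 * Real.log (RCLike.re ⟪u, Matrix.toEuclideanLin (Bt x) u⟫_ℂ) - K * ∑ i, v i ^ 2 ≤
          Real.log (RCLike.re ⟪u, Matrix.toEuclideanLin (Bt (x + v)) u⟫_ℂ) +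
            Real.log (RCLike.re ⟪u, Matrix.toEuclideanLin (Bt (x - v)) u⟫_ℂ))
    {Λ : ℝ} {qs : Fin 3 → ℝ} {us : EuclideanSpace ℂ (Fin n)} (hus : ‖us‖ = 1)
    (hΛ : RCLike.re ⟪us, Matrix.toEuclideanLin (Bt qs) us⟫_ℂ = Λ)
    (hsup : ∀ (q : Fin 3 → ℝ) (u : EuclideanSpace ℂ (Fin n)), ‖u‖ = 1 → RCLike.re ⟪u, Matrix.toEuclideanLin (Bt q) u⟫_ℂ ≤ Λ)
    {m₀ : ℕ} (htwo : ∀ m : ℕ, m₀ ≤ m →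
      (1 / 2 : ℝ) * ∑ p : Fin N × Fin N × Fin N, ((Bt (latticeAngle N p) ^ (m + 2)).trace).re ≤ traceExcess r.ρ β N (m + 2) ∧
      traceExcess r.ρ β N (m + 2) ≤ 2 * ∑ p : Fin N × Fin N × Fin N, ((Bt (latticeAngle N p) ^ (m + 2)).trace).re) :
    ∃ W : ℝ, 0 < W ∧
      (⨅ k : ℕ, traceExcess r.ρ β N (k + 2) ^ ((1 : ℝ) / ((k : ℝ) + 2))) = W ∧
      W ≤ Λ ∧ Λ * Real.exp (-(3 * K * Real.pi ^ 2 / (N : ℝ) ^ 2)) ≤ W ∧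
      ∀ m : ℕ, ∑ p : Fin N × Fin N × Fin N, ((Bt (latticeAngle N p) ^ (m + 2)).trace).re ≤
        (n : ℝ) * (N : ℝ) ^ 3 * W ^ (m + 2) := by
  haveI : NeZero n := ⟨by omega⟩
  haveI : SecondCountableTopology G :=
    (r.continuous.isClosedEmbedding r.injective).isEmbedding.secondCountableTopology
  -- weights = eigenvalues of the Bloch blocks
  set w : (Fin N × Fin N × Fin N) × Fin n → ℝ := fun j => (hH (latticeAngle N j.1)).eigenvalues j.2 with hw
  have hwpos : ∀ j, 0 < w j := by
    intro j
    have hu : ‖(hH (latticeAngle N j.1)).eigenvectorBasis j.2‖ = 1 :=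
      (hH (latticeAngle N j.1)).eigenvectorBasis.orthonormal.1 j.2
    have h := (hray _ hu).1 (latticeAngle N j.1)
    rwa [re_inner_toEuclideanLin_eigenvectorBasis] at h
  have htr : ∀ t : ℕ, ∑ j, w j ^ t = ∑ p : Fin N × Fin N × Fin N, ((Bt (latticeAngle N p) ^ t).trace).re := by
    intro t
    rw [Fintype.sum_prod_type]
    refine Finset.sum_congr rfl fun p _ => ?_
    rw [re_trace_pow_eq_sum_eigenvalues_pow (hH (latticeAngle N p)) t]
  obtain ⟨jstar, -, hjstar⟩ := Finset.exists_max_image Finset.univ w Finset.univ_nonempty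
  set W : ℝ := w jstar with hWdef
  have hW : 0 < W := hwpos jstar
  have hwle : ∀ j, w j ≤ W := fun j => hjstar j (Finset.mem_univ j)
  have hcard : (Fintype.card ((Fin N × Fin N × Fin N) × Fin n) : ℝ) = (n : ℝ) * (N : ℝ) ^ 3 := by
    simp only [Fintype.card_prod, Fintype.card_fin]
    push_cast
    ring
  -- (iv) the block traces are at most `n N³ W^t`
  have hiv : ∀ t : ℕ, ∑ p : Fin N × Fin N × Fin N, ((Bt (latticeAngle N p) ^ t).trace).re ≤ (n : ℝ) * (N : ℝ) ^ 3 * W ^ t := by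
    intro t
    rw [← htr, ← hcard]
    calc ∑ j, w j ^ t ≤ ∑ _j : (Fin N × Fin N × Fin N) × Fin n, W ^ t :=
          Finset.sum_le_sum fun j _ => pow_le_pow_left₀ (hwpos j).le (hwle j) _
      _ = (Fintype.card ((Fin N × Fin N × Fin N) × Fin n) : ℝ) * W ^ t := by
          rw [Finset.sum_const, Finset.card_univ, nsmul_eq_mul]
  -- (i) `q = W` from the two eventual bounds
  have hNpos0 : (0 : ℝ) < N := by exact_mod_cast Nat.pos_of_ne_zero (NeZero.ne N)
  have hnpos : (0 : ℝ) < n := by exact_mod_cast hn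
  have hD : 0 < 2 * ((n : ℝ) * (N : ℝ) ^ 3) := mul_pos two_pos (mul_pos hnpos (pow_pos hNpos0 3))
  have hq_le : (⨅ k : ℕ, traceExcess r.ρ β N (k + 2) ^ ((1 : ℝ) / ((k : ℝ) + 2))) ≤ W := by
    refine rate_le_of_eventually_traceExcess_le_mul_pow r hβ N hD hW.le m₀ fun k hk => ?_
    calc traceExcess r.ρ β N (k + 2) ≤ 2 * ∑ p : Fin N × Fin N × Fin N, ((Bt (latticeAngle N p) ^ (k + 2)).trace).re :=
          (htwo k hk).2
      _ ≤ 2 * ((n : ℝ) * (N : ℝ) ^ 3 * W ^ (k + 2)) := mul_le_mul_of_nonneg_left (hiv (k + 2)) (by norm_num)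
      _ = 2 * ((n : ℝ) * (N : ℝ) ^ 3) * W ^ (k + 2) := by ring
  have hq_ge : W ≤ (⨅ k : ℕ, traceExcess r.ρ β N (k + 2) ^ ((1 : ℝ) / ((k : ℝ) + 2))) := by
    refine le_rate_of_eventually_mul_pow_le_traceExcess r hβ N (c := 1 / 2) (by norm_num) hW.le m₀ fun k hk => ?_
    calc (1 / 2 : ℝ) * W ^ (k + 2) = (1 / 2 : ℝ) * w jstar ^ (k + 2) := by rw [hWdef]
      _ ≤ (1 / 2 : ℝ) * ∑ j, w j ^ (k + 2) := by
          refine mul_le_mul_of_nonneg_left ?_ (by norm_num)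
          exact Finset.single_le_sum (f := fun j => w j ^ (k + 2)) (fun j _ => pow_nonneg (hwpos j).le _)
            (Finset.mem_univ jstar)
      _ = (1 / 2 : ℝ) * ∑ p : Fin N × Fin N × Fin N, ((Bt (latticeAngle N p) ^ (k + 2)).trace).re := by rw [htr]
      _ ≤ traceExcess r.ρ β N (k + 2) := (htwo k hk).1
  have hqW : (⨅ k : ℕ, traceExcess r.ρ β N (k + 2) ^ ((1 : ℝ) / ((k : ℝ) + 2))) = W := le_antisymm hq_le hq_ge
  -- (ii) `W ≤ Λ`: `W` is the Rayleigh quotient of a unit eigenvector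
  have hii : W ≤ Λ := by
    have hu : ‖(hH (latticeAngle N jstar.1)).eigenvectorBasis jstar.2‖ = 1 :=
      (hH (latticeAngle N jstar.1)).eigenvectorBasis.orthonormal.1 jstar.2
    have h := hsup (latticeAngle N jstar.1) _ hu
    rwa [re_inner_toEuclideanLin_eigenvectorBasis] at h
  -- (iii) `Λ e^{−3Kπ²/N²} ≤ W`: round the maximiser `qs` to the nearest lattice angle
  have hiii : Λ * Real.exp (-(3 * K * Real.pi ^ 2 / (N : ℝ) ^ 2)) ≤ W := by
    have hNpos : (0 : ℝ) < N := by exact_mod_cast Nat.pos_of_ne_zero (NeZero.ne N)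
    have hNne : (N : ℝ) ≠ 0 := hNpos.ne'
    have hpi : 0 < Real.pi := Real.pi_pos
    -- integer rounding of each coordinate of `qs` in units of `2π/N`
    set kz : Fin 3 → ℤ := fun i => round (qs i * N / (2 * Real.pi)) with hkz
    -- the residue `j i ∈ [0, N)` of `kz i` and the quotient
    have hjlt : ∀ i, (kz i % (N : ℤ)).toNat < N := by
      intro i
      have h1 : kz i % (N : ℤ) < N := Int.emod_lt_of_pos _ (by exact_mod_cast Nat.pos_of_ne_zero (NeZero.ne N))
      have h0 : 0 ≤ kz i % (N : ℤ) := Int.emod_nonneg _ (by exact_mod_cast (NeZero.ne N))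
      omega
    set p : Fin N × Fin N × Fin N :=
      (⟨(kz 0 % (N : ℤ)).toNat, hjlt 0⟩, ⟨(kz 1 % (N : ℤ)).toNat, hjlt 1⟩, ⟨(kz 2 % (N : ℤ)).toNat, hjlt 2⟩) with hp
    -- the lattice angle of `p` is `2π kz/N` up to `2π`-periods
    have hcoord : ∀ i : Fin 3, ((coordsF p i).val : ℤ) = kz i % (N : ℤ) := by
      intro i
      have h0 : ∀ i, 0 ≤ kz i % (N : ℤ) := fun i => Int.emod_nonneg _ (by exact_mod_cast (NeZero.ne N))
      fin_cases i <;> simp [coordsF, hp, Int.toNat_of_nonneg (h0 _)]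
    set v : Fin 3 → ℝ := fun i => qs i - 2 * Real.pi * (kz i : ℝ) / N with hv
    have hvbound : ∀ i, v i ^ 2 ≤ (Real.pi / N) ^ 2 := by
      intro i
      have h1 : |qs i * N / (2 * Real.pi) - round (qs i * N / (2 * Real.pi))| ≤ 1 / 2 := abs_sub_round _
      have h2 : v i = (2 * Real.pi / N) * (qs i * N / (2 * Real.pi) - (kz i : ℝ)) := by
        rw [hv]
        field_simp
      have h3 : |v i| ≤ Real.pi / N := by
        rw [h2, abs_mul, abs_of_pos (by positivity)]
        calc 2 * Real.pi / N * |qs i * N / (2 * Real.pi) - (kz i : ℝ)| ≤ 2 * Real.pi / N * (1 / 2) :=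
              mul_le_mul_of_nonneg_left h1 (by positivity)
          _ = Real.pi / N := by ring
      calc v i ^ 2 = |v i| ^ 2 := (sq_abs _).symm
        _ ≤ (Real.pi / N) ^ 2 := pow_le_pow_left₀ (abs_nonneg _) h3 2
    have hvsum : ∑ i, v i ^ 2 ≤ 3 * Real.pi ^ 2 / (N : ℝ) ^ 2 := by
      calc ∑ i, v i ^ 2 ≤ ∑ _i : Fin 3, (Real.pi / N) ^ 2 := Finset.sum_le_sum fun i _ => hvbound i
        _ = 3 * Real.pi ^ 2 / (N : ℝ) ^ 2 := by
            rw [Finset.sum_const, Finset.card_univ, Fintype.card_fin, nsmul_eq_mul]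
            field_simp
            ring
    -- `θ(p) = qs − v + 2π z`
    have hz : ∃ z : Fin 3 → ℤ, latticeAngle N p = fun i => (qs - v) i + 2 * Real.pi * z i := by
      refine ⟨fun i => -(kz i / (N : ℤ)), funext fun i => ?_⟩
      have h1 := Int.emod_add_mul_ediv (kz i) (N : ℤ)
      have h2 : ((coordsF p i).val : ℝ) = (kz i : ℝ) - (N : ℝ) * ((kz i / (N : ℤ) : ℤ) : ℝ) := by
        have h3 : ((coordsF p i).val : ℤ) = kz i - (N : ℤ) * (kz i / (N : ℤ)) := by rw [hcoord i]; omega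
        exact_mod_cast h3
      simp only [latticeAngle, Pi.sub_apply, hv, h2]
      push_cast
      field_simp
      ring
    obtain ⟨z, hz⟩ := hz
    obtain ⟨hpos, hsd⟩ := hray us hus
    -- second difference at `qs` in direction `v`
    have h1 := hsd qs v
    have h2 : Real.log (RCLike.re ⟪us, Matrix.toEuclideanLin (Bt (qs + v)) us⟫_ℂ) ≤ Real.log Λ :=
      Real.log_le_log (hpos _) (hsup _ _ hus)
    have hΛpos : 0 < Λ := hΛ ▸ hpos qs
    have h3 : Real.log Λ - K * (3 * Real.pi ^ 2 / (N : ℝ) ^ 2) ≤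
        Real.log (RCLike.re ⟪us, Matrix.toEuclideanLin (Bt (qs - v)) us⟫_ℂ) := by
      rw [hΛ] at h1
      nlinarith [mul_le_mul_of_nonneg_left hvsum hK]
    -- the Rayleigh quotient at the lattice angle `θ(p) ≡ qs − v` is at most `W`
    have h4 : RCLike.re ⟪us, Matrix.toEuclideanLin (Bt (qs - v)) us⟫_ℂ ≤ W := by
      have h5 : Bt (latticeAngle N p) = Bt (qs - v) := by rw [hz, hper]
      have h6 := re_inner_toEuclideanLin_le (hH (latticeAngle N p)) us (M := W) fun i => hwle (p, i)
      rw [hus, one_pow, mul_one, h5] at h6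
      exact h6
    have h7 : Real.log Λ + (-(3 * K * Real.pi ^ 2 / (N : ℝ) ^ 2)) ≤ Real.log W := by
      have h8 := Real.log_le_log (hpos _) h4
      have h9 : K * (3 * Real.pi ^ 2 / (N : ℝ) ^ 2) = 3 * K * Real.pi ^ 2 / (N : ℝ) ^ 2 := by ring
      linarith
    calc Λ * Real.exp (-(3 * K * Real.pi ^ 2 / (N : ℝ) ^ 2))
        = Real.exp (Real.log Λ + (-(3 * K * Real.pi ^ 2 / (N : ℝ) ^ 2))) := by rw [Real.exp_add, Real.exp_log hΛpos]
      _ ≤ Real.exp (Real.log W) := Real.exp_le_exp.2 h7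
      _ = W := Real.exp_log hW
  exact ⟨W, hW, hqW, hii, hiii, fun m => hiv (m + 2)⟩

end PerVolume

/-! ### §3 The three cruxes and the rung from the effective Bloch symbol family -/

/-- **K3′ from the family**: `EffectiveBlochSymbolFamily → OneGlueballBandDichotomy` (through the Bloch door). -/
theorem oneGlueballBandDichotomy_of_effectiveBlochSymbolFamily (h : EffectiveBlochSymbolFamily) :
    OneGlueballBandDichotomy := by
  refine oneGlueballBandDichotomy_of_blochSymbol fun G _ _ _ _ => ?_
  letI : MeasurableSpace G := borel G
  haveI : BorelSpace G := ⟨rfl⟩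
  intro r
  obtain ⟨K, hK, n₀, D', hD', L₀, hL₀⟩ := h G r
  refine ⟨K, hK, L₀, fun β hβ0 hβ N _ hN => ?_⟩
  rcases hL₀ β hβ0 hβ with hesc | ⟨ℓ, hdata⟩
  · exact Or.inl (hesc N hN)
  · obtain ⟨n, hn, -, Bt, hH, hper, hray, -, m₀, htwo⟩ := hdata N hN
    refine Or.inr ⟨n, hn, Bt, hH, hper, hray, ⟨m₀, fun m hm => (htwo m (Or.inl hm)).2⟩, fun m hm => (htwo m (Or.inr hm)).1⟩

/-- **K2 from the family**: `EffectiveBlochSymbolFamily → ThermalMultiplicityUpper`, with `A = 2n₀ + 1`: at the crux time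
`x_t ≤ 2Σ_p Re tr B̃(θp)^t ≤ 2n N³ W^t` and `W = q_N`. -/
theorem thermalMultiplicityUpper_of_effectiveBlochSymbolFamily (h : EffectiveBlochSymbolFamily) :
    ThermalMultiplicityUpper := by
  intro G _ _ _ _
  letI : MeasurableSpace G := borel G
  haveI : BorelSpace G := ⟨rfl⟩
  intro r
  obtain ⟨K, hK, n₀, D', hD', L₀, hL₀⟩ := h G r
  refine ⟨2 * n₀ + 1, by positivity, L₀, fun β hβ0 hβ N _ m hm hN => ?_⟩
  haveI : SecondCountableTopology G :=
    (r.continuous.isClosedEmbedding r.injective).isEmbedding.secondCountableTopology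
  have hq0 : 0 ≤ (⨅ k : ℕ, traceExcess r.ρ β N (k + 2) ^ ((1 : ℝ) / ((k : ℝ) + 2))) :=
    Rate.rate_nonneg r.continuous r.mem_unitary hβ0 N
  rcases hL₀ β hβ0 hβ with hesc | ⟨ℓ, hdata⟩
  · rw [traceExcess_eq_zero_of_rate_eq_zero r hβ0 N (hesc N hN) m]
    positivity
  · obtain ⟨n, hn, hnn₀, Bt, hH, hper, hray, ⟨Λ, qs, us, hus, hΛ, hsup, -⟩, m₀, htwo⟩ := hdata N hN
    obtain ⟨W, hW, hqW, -, -, hiv⟩ := rate_eq_and_bracket_of_blochSymbol r hβ0 N hK hn Bt hH hper hray hus hΛ hsup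
      (m₀ := m₀) fun m hm => htwo m (Or.inl hm)
    rw [hqW]
    have hN3 : (0 : ℝ) ≤ (N : ℝ) ^ 3 := by positivity
    calc traceExcess r.ρ β N (m + 2)
        ≤ 2 * ∑ p : Fin N × Fin N × Fin N, ((Bt (latticeAngle N p) ^ (m + 2)).trace).re := (htwo m (Or.inr hm)).2
      _ ≤ 2 * ((n : ℝ) * (N : ℝ) ^ 3 * W ^ (m + 2)) := mul_le_mul_of_nonneg_left (hiv m) (by norm_num)
      _ ≤ 2 * ((n₀ : ℝ) * (N : ℝ) ^ 3 * W ^ (m + 2)) :=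
          mul_le_mul_of_nonneg_left (mul_le_mul_of_nonneg_right
            (mul_le_mul_of_nonneg_right (by exact_mod_cast hnn₀) hN3) (pow_nonneg hW.le _)) (by norm_num)
      _ ≤ (2 * (n₀ : ℝ) + 1) * (N : ℝ) ^ 3 * W ^ (m + 2) := by
          nlinarith [mul_nonneg hN3 (pow_nonneg hW.le (m + 2))]

/-- **K1 from the family**: `EffectiveBlochSymbolFamily → GapStableUnderRefinement`, with `D = 2(D' + 3Kπ²)`:
`|log q_N − ℓ| ≤ D'/N + 3Kπ²/N² ≤ (D' + 3Kπ²)/N` at both volumes. -/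
theorem gapStableUnderRefinement_of_effectiveBlochSymbolFamily (h : EffectiveBlochSymbolFamily) :
    GapStableUnderRefinement := by
  intro G _ _ _ _
  letI : MeasurableSpace G := borel G
  haveI : BorelSpace G := ⟨rfl⟩
  intro r
  obtain ⟨K, hK, n₀, D', hD', L₀, hL₀⟩ := h G r
  set E : ℝ := D' + 3 * K * Real.pi ^ 2 with hE
  have hE0 : 0 ≤ E := by positivity
  refine ⟨2 * E, by positivity, max L₀ 1, fun β hβ0 hβ L _ L' _ hL hLL' hL'L => ?_⟩
  have hL₀L : L₀ ≤ L := le_trans (le_max_left _ _) hL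
  have hL₀L' : L₀ ≤ L' := by omega
  have hLpos : (0 : ℝ) < L := by exact_mod_cast Nat.pos_of_ne_zero (NeZero.ne L)
  have hL'pos : (0 : ℝ) < L' := by exact_mod_cast Nat.pos_of_ne_zero (NeZero.ne L')
  have hLL'r : (L : ℝ) ≤ L' := by exact_mod_cast (show L ≤ L' by omega)
  rcases hL₀ β hβ0 hβ with hesc | ⟨ℓ, hdata⟩
  · rw [hesc L hL₀L, hesc L' hL₀L', mul_zero]
  · -- `|log q_N − ℓ| ≤ E/N` at every volume `N ≥ L₀`
    have key : ∀ (N : ℕ) [NeZero N], L₀ ≤ N →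
        ∃ W : ℝ, 0 < W ∧ (⨅ k : ℕ, traceExcess r.ρ β N (k + 2) ^ ((1 : ℝ) / ((k : ℝ) + 2))) = W ∧
          |Real.log W - ℓ| ≤ E / (N : ℝ) := by
      intro N _ hN
      obtain ⟨n, hn, -, Bt, hH, hper, hray, ⟨Λ, qs, us, hus, hΛ, hsup, hvol⟩, m₀, htwo⟩ := hdata N hN
      obtain ⟨W, hW, hqW, hii, hiii, -⟩ := rate_eq_and_bracket_of_blochSymbol r hβ0 N hK hn Bt hH hper hray hus hΛ hsup
        (m₀ := m₀) fun m hm => htwo m (Or.inl hm)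
      refine ⟨W, hW, hqW, ?_⟩
      have hNpos : (0 : ℝ) < N := by exact_mod_cast Nat.pos_of_ne_zero (NeZero.ne N)
      have hN1 : (1 : ℝ) ≤ N := by exact_mod_cast Nat.pos_of_ne_zero (NeZero.ne N)
      have hΛpos : 0 < Λ := lt_of_lt_of_le hW hii
      have hup : Real.log W ≤ Real.log Λ := Real.log_le_log hW hii
      have hlow : Real.log Λ - 3 * K * Real.pi ^ 2 / (N : ℝ) ^ 2 ≤ Real.log W := by
        have h1 := Real.log_le_log (mul_pos hΛpos (Real.exp_pos _)) hiii
        rwa [Real.log_mul hΛpos.ne' (Real.exp_pos _).ne', Real.log_exp] at h1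
      have hsq : 3 * K * Real.pi ^ 2 / (N : ℝ) ^ 2 ≤ 3 * K * Real.pi ^ 2 / (N : ℝ) := by
        apply div_le_div_of_nonneg_left (by positivity) hNpos
        nlinarith
      rw [abs_le] at hvol ⊢
      constructor
      · have : E / (N : ℝ) = D' / N + 3 * K * Real.pi ^ 2 / N := by rw [hE]; ring
        rw [this]
        linarith [hvol.1]
      · have : E / (N : ℝ) = D' / N + 3 * K * Real.pi ^ 2 / N := by rw [hE]; ring
        rw [this]
        have : 0 ≤ 3 * K * Real.pi ^ 2 / (N : ℝ) := by positivity
        linarith [hvol.2]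
    obtain ⟨W, hW, hqW, habs⟩ := key L hL₀L
    obtain ⟨W', hW', hqW', habs'⟩ := key L' hL₀L'
    rw [hqW, hqW']
    have h1 : Real.log W' - Real.log W ≤ E / (L' : ℝ) + E / (L : ℝ) := by
      rw [abs_le] at habs habs'
      linarith [habs.1, habs'.2]
    have h2 : E / (L' : ℝ) ≤ E / (L : ℝ) := div_le_div_of_nonneg_left hE0 hLpos hLL'r
    have h3 : Real.log W' ≤ Real.log W + 2 * E / (L : ℝ) := by
      have : 2 * E / (L : ℝ) = E / L + E / L := by ring
      linarith
    calc W' = Real.exp (Real.log W') := (Real.exp_log hW').symm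
      _ ≤ Real.exp (Real.log W + 2 * E / (L : ℝ)) := Real.exp_le_exp.2 h3
      _ = Real.exp (2 * E / (L : ℝ)) * W := by rw [Real.exp_add, Real.exp_log hW, mul_comm]

/-- **The rung from the family**: `EffectiveBlochSymbolFamily → ColdDoublingRecursionStrongCoupling`, by the route's deciding theorem
`closes` and the proved glue `assembly2_proof`.  (RECORD-type strong-coupling rung; nothing about the Yang–Mills mass gap.) -/
theorem coldDoublingRecursionStrongCoupling_of_effectiveBlochSymbolFamily (h : EffectiveBlochSymbolFamily) :
    Summit.QuantumFields.YangMills.Cruxes.IR.ColdPurityBridge.ColdDoublingRecursionStrongCoupling :=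
  closes (gapStableUnderRefinement_of_effectiveBlochSymbolFamily h) (thermalMultiplicityUpper_of_effectiveBlochSymbolFamily h)
    (oneGlueballBandDichotomy_of_effectiveBlochSymbolFamily h) assembly2_proof

end Summit.QuantumFields.YangMills.Theorems.GlueballBandRecursion.Band

end
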